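import Mathlib
import Summits.QuantumFields.QCD.Theorems.PauliWegnerSeaPhaseQuenchedFlavourDecayNegMomentSmallBalls

/-!
# Tilted negative moments from flatness and relative small-ball bounds

Stub `stub_tiltedNegMoment` of crux `stmt-QuantumFields-9151`
(`Summit.QuantumFields.QCD.Theses.PauliWegnerSea.PhaseQuenchedFlavourDecay`,
line `crossing-split-integrability`).

Setting: a probability space `(Ω, μ)` carrying bounded measurable non-negative `w, F, G`; write
`Z = ∫ w dμ`, `I_F = ∫ F w dμ`, `I_G = ∫ G w dμ`, `I_FG = ∫ F G w dμ`. Hypotheses: the flatness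
bounds `F Z ≤ C I_F` and `G Z ≤ C I_G` (pointwise) and the relative small-ball bound
`∫ 1{F Z ≤ η I_F} w dμ ≤ C η ^ c Z` for every `η > 0`. Claim: for `0 < ε < c`,
`∫⁻ (G w) F ^ (-ε) dμ ≤ K I_G ^ (1 + ε) I_FG ^ (-ε)` with `K = K(C, c, ε)` only.

Proof: tilt by `G w`, i.e. pass to the probability measure `ν₀ = (G w / I_G) μ`. Flatness of `G`
gives `Z ν₀(A) ≤ C ∫_A w dμ`, flatness of `F` gives `(I_FG / I_G) Z ≤ C I_F`, so the small-ball
bound transfers to `ν₀ {F ≤ η I_FG / I_G} ≤ C ^ 2 C ^ c η ^ c`. The layer-cake lemma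
`stub_negMomentOfSmallBalls` (constant `C ^ 2 C ^ c`, exponent `c`, `s = ε`, level `I_FG / I_G`)
then bounds `∫ F ^ (-ε) dν₀ ≤ K (I_FG / I_G) ^ (-ε)`, which is the claim after multiplying by
`I_G`. The `ℝ≥0∞` power `ofReal (F ω) ^ (-ε)` agrees with `ofReal (F ω ^ (-ε))` off the
`ν₀`-null set `{F = 0}` (null by the small-ball bound as `η → 0`).
-/

noncomputable section

namespace Summit.QuantumFields.QCD.Cruxes.PhaseQuenchedFlavourDecay.CrossingSplitIntegrability

open MeasureTheory Filter Topology

/-- A measurable real function with values in `[0, B]` is integrable for a finite measure. -/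
private theorem integrable_of_nonneg_of_le_const {Ω : Type*} [MeasurableSpace Ω]
    {μ : Measure Ω} [IsFiniteMeasure μ] {f : Ω → ℝ} (hf : Measurable f) (B : ℝ)
    (h0 : ∀ ω, 0 ≤ f ω) (hB : ∀ ω, f ω ≤ B) : Integrable f μ :=
  Integrable.of_mem_Icc 0 B hf.aemeasurable (Eventually.of_forall fun ω => ⟨h0 ω, hB ω⟩)

/-- **Tilted negative moments** (registered stub `stub_tiltedNegMoment`).
On a probability space with bounded measurable non-negative `w, F, G`, the flatness bounds
`F ∫ w ≤ C ∫ F w`, `G ∫ w ≤ C ∫ G w` and the relative small-ball bound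
`∫ 1{F ∫ w ≤ η ∫ F w} w ≤ C η ^ c ∫ w` (all `η > 0`) imply, for `0 < ε < c`,
`∫⁻ (G w) F ^ (-ε) dμ ≤ K (∫ G w) ^ (1 + ε) (∫ F G w) ^ (-ε)` with `K` depending on
`(C, c, ε)` only. -/
theorem stub_tiltedNegMoment :
    ∀ (C c ε : ℝ), 0 < C → 0 < c → 0 < ε → ε < c → ∃ K : ℝ, 0 < K ∧
      ∀ (Ω : Type) [MeasurableSpace Ω] (μ : MeasureTheory.Measure Ω)
        [MeasureTheory.IsProbabilityMeasure μ] (w F G : Ω → ℝ),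
        Measurable w → Measurable F → Measurable G →
        (∀ ω, 0 ≤ w ω) → (∀ ω, 0 ≤ F ω) → (∀ ω, 0 ≤ G ω) →
        (∃ B : ℝ, ∀ ω, w ω ≤ B ∧ F ω ≤ B ∧ G ω ≤ B) →
        0 < ∫ ω, F ω * G ω * w ω ∂μ →
        (∀ ω, F ω * ∫ ω', w ω' ∂μ ≤ C * ∫ ω', F ω' * w ω' ∂μ) →
        (∀ ω, G ω * ∫ ω', w ω' ∂μ ≤ C * ∫ ω', G ω' * w ω' ∂μ) →
        (∀ η : ℝ, 0 < η →
          ∫ ω, (if F ω * ∫ ω', w ω' ∂μ ≤ η * ∫ ω', F ω' * w ω' ∂μ then (1 : ℝ) else 0) * w ω ∂μ ≤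
            C * η ^ c * ∫ ω', w ω' ∂μ) →
        ∫⁻ ω, ENNReal.ofReal (G ω * w ω) * ENNReal.ofReal (F ω) ^ (-ε) ∂μ ≤
          ENNReal.ofReal (K * (∫ ω, G ω * w ω ∂μ) ^ (1 + ε) *
            (∫ ω, F ω * G ω * w ω ∂μ) ^ (-ε)) := by
  intro C c ε hC hc hε hεc
  -- the constant: the layer-cake constant for small-ball constant `C ^ 2 * C ^ c`, exponents `c, ε`
  obtain ⟨K, hK, hmain⟩ :=
    stub_negMomentOfSmallBalls (C ^ 2 * C ^ c) c ε (by positivity) hε hεc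
  refine ⟨K, hK, ?_⟩
  intro Ω _ μ _ w F G hw hF hG hw0 hF0 hG0 hbdd hFGpos hFflat hGflat hsmall
  obtain ⟨B, hB⟩ := hbdd
  set Z : ℝ := ∫ ω, w ω ∂μ with hZ_def
  set IF : ℝ := ∫ ω, F ω * w ω ∂μ with hIF_def
  set IG : ℝ := ∫ ω, G ω * w ω ∂μ with hIG_def
  set IFG : ℝ := ∫ ω, F ω * G ω * w ω ∂μ with hIFG_def
  -- integrability of the bounded integrands `w` and `G w`
  have hwint : Integrable w μ :=
    integrable_of_nonneg_of_le_const hw B hw0 fun ω => (hB ω).1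
  have hGwint : Integrable (fun ω => G ω * w ω) μ :=
    integrable_of_nonneg_of_le_const (hG.mul hw) (B * B) (fun ω => mul_nonneg (hG0 ω) (hw0 ω))
      fun ω => mul_le_mul (hB ω).2.2 (hB ω).1 (hw0 ω) ((hw0 ω).trans (hB ω).1)
  -- positivity of the normalisations: `0 < IFG ≤ B * IG` and `0 < IG ≤ B * Z`
  have hFGle : IFG ≤ B * IG := by
    have h : IFG ≤ ∫ ω, B * (G ω * w ω) ∂μ :=
      integral_mono_of_nonneg
        (ae_of_all _ fun ω => mul_nonneg (mul_nonneg (hF0 ω) (hG0 ω)) (hw0 ω))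
        (hGwint.const_mul B)
        (ae_of_all _ fun ω => (mul_assoc _ _ _).trans_le
          (mul_le_mul_of_nonneg_right (hB ω).2.1 (mul_nonneg (hG0 ω) (hw0 ω))))
    rwa [integral_const_mul] at h
  have hIGpos : 0 < IG := by
    refine lt_of_le_of_ne (integral_nonneg fun ω => mul_nonneg (hG0 ω) (hw0 ω)) fun h0 => ?_
    rw [← h0, mul_zero] at hFGle
    exact lt_irrefl _ (hFGpos.trans_le hFGle)
  have hIGle : IG ≤ B * Z := by
    have h : IG ≤ ∫ ω, B * w ω ∂μ :=
      integral_mono_of_nonneg (ae_of_all _ fun ω => mul_nonneg (hG0 ω) (hw0 ω))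
        (hwint.const_mul B) (ae_of_all _ fun ω => mul_le_mul_of_nonneg_right (hB ω).2.2 (hw0 ω))
    rwa [integral_const_mul] at h
  have hZpos : 0 < Z := by
    refine lt_of_le_of_ne (integral_nonneg fun ω => hw0 ω) fun h0 => ?_
    rw [← h0, mul_zero] at hIGle
    exact lt_irrefl _ (hIGpos.trans_le hIGle)
  -- flatness of `F` integrated against `G w`: `IFG * Z ≤ C * IF * IG`
  have hZIFG : IFG * Z ≤ C * IF * IG := by
    have h : ∫ ω, F ω * G ω * w ω * Z ∂μ ≤ ∫ ω, C * IF * (G ω * w ω) ∂μ :=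
      integral_mono_of_nonneg
        (ae_of_all _ fun ω =>
          mul_nonneg (mul_nonneg (mul_nonneg (hF0 ω) (hG0 ω)) (hw0 ω)) hZpos.le)
        (hGwint.const_mul (C * IF))
        (ae_of_all _ fun ω => show F ω * G ω * w ω * Z ≤ C * IF * (G ω * w ω) from
          calc F ω * G ω * w ω * Z = F ω * Z * (G ω * w ω) := by ring
            _ ≤ C * IF * (G ω * w ω) :=
                mul_le_mul_of_nonneg_right (hFflat ω) (mul_nonneg (hG0 ω) (hw0 ω)))
    rwa [integral_mul_const, integral_const_mul] at h
  have hMZ : IFG / IG * Z ≤ C * IF := by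
    rw [div_mul_eq_mul_div, div_le_iff₀ hIGpos]
    exact hZIFG
  have hMpos : 0 < IFG / IG := div_pos hFGpos hIGpos
  -- the tilted probability measure `ν₀ = (G w / IG) μ`
  have hρ0 : ∀ ω, 0 ≤ G ω * w ω / IG := fun ω =>
    div_nonneg (mul_nonneg (hG0 ω) (hw0 ω)) hIGpos.le
  have hρmeas : Measurable fun ω => G ω * w ω / IG := (hG.mul hw).div_const IG
  have hρint : Integrable (fun ω => G ω * w ω / IG) μ := hGwint.div_const IG
  have hρ1 : ∫ ω, G ω * w ω / IG ∂μ = 1 := by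
    rw [integral_div]
    exact div_self hIGpos.ne'
  obtain ⟨ν₀, hν₀_def⟩ :
      ∃ ν : Measure Ω, ν = μ.withDensity fun ω => ENNReal.ofReal (G ω * w ω / IG) := ⟨_, rfl⟩
  haveI hν₀P : IsProbabilityMeasure ν₀ := by
    refine ⟨?_⟩
    rw [hν₀_def, withDensity_apply _ MeasurableSet.univ, Measure.restrict_univ,
      ← ofReal_integral_eq_lintegral_ofReal hρint (ae_of_all _ hρ0), hρ1, ENNReal.ofReal_one]
  have hν₀A : ∀ A : Set Ω, MeasurableSet A →
      (ν₀ A).toReal = ∫ ω, A.indicator (fun ω => G ω * w ω / IG) ω ∂μ := by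
    intro A hA
    rw [hν₀_def, withDensity_apply _ hA,
      ← ofReal_integral_eq_lintegral_ofReal hρint.integrableOn (ae_of_all _ hρ0),
      ENNReal.toReal_ofReal (integral_nonneg hρ0 : 0 ≤ ∫ ω in A, G ω * w ω / IG ∂μ),
      integral_indicator hA]
  -- transfer of the relative small-ball bound to `ν₀` at the level `IFG / IG`
  have hsmallν : ∀ η : ℝ, 0 < η →
      (ν₀ {ω | F ω ≤ η * (IFG / IG)}).toReal ≤ C ^ 2 * C ^ c * η ^ c := by
    intro η hη
    have hA : MeasurableSet {ω | F ω ≤ η * (IFG / IG)} := measurableSet_le hF measurable_const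
    rw [hν₀A _ hA]
    -- pointwise: `Z * 1_A * (G w / IG) ≤ C * 1{F Z ≤ (C η) IF} * w`
    have hpt : ∀ ω, Z * {ω | F ω ≤ η * (IFG / IG)}.indicator (fun ω => G ω * w ω / IG) ω ≤
        C * ((if F ω * Z ≤ C * η * IF then (1 : ℝ) else 0) * w ω) := by
      intro ω
      by_cases hω : F ω ≤ η * (IFG / IG)
      · have hω' : F ω * Z ≤ C * η * IF :=
          calc F ω * Z ≤ η * (IFG / IG) * Z := mul_le_mul_of_nonneg_right hω hZpos.le
            _ = η * (IFG / IG * Z) := mul_assoc _ _ _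
            _ ≤ η * (C * IF) := mul_le_mul_of_nonneg_left hMZ hη.le
            _ = C * η * IF := by ring
        have hmem : ω ∈ {ω | F ω ≤ η * (IFG / IG)} := hω
        rw [Set.indicator_of_mem hmem, if_pos hω', one_mul, mul_div_assoc', div_le_iff₀ hIGpos]
        calc Z * (G ω * w ω) = G ω * Z * w ω := by ring
          _ ≤ C * IG * w ω := mul_le_mul_of_nonneg_right (hGflat ω) (hw0 ω)
          _ = C * w ω * IG := by ring
      · have hmem : ω ∉ {ω | F ω ≤ η * (IFG / IG)} := hω
        rw [Set.indicator_of_notMem hmem, mul_zero]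
        exact mul_nonneg hC.le (mul_nonneg (by positivity) (hw0 ω))
    -- the comparison function is integrable (bounded by `B`)
    have hιm : Measurable fun ω => (if F ω * Z ≤ C * η * IF then (1 : ℝ) else 0) :=
      Measurable.ite (measurableSet_le (hF.mul_const Z) measurable_const) measurable_const
        measurable_const
    have hι1 : ∀ ω, (if F ω * Z ≤ C * η * IF then (1 : ℝ) else 0) ≤ 1 := fun ω => by
      split_ifs <;> norm_num
    have hint : Integrable (fun ω => (if F ω * Z ≤ C * η * IF then (1 : ℝ) else 0) * w ω) μ :=
      integrable_of_nonneg_of_le_const (hιm.mul hw) B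
        (fun ω => mul_nonneg (by positivity) (hw0 ω))
        fun ω => (mul_le_mul_of_nonneg_right (hι1 ω) (hw0 ω)).trans
          ((one_mul _).trans_le (hB ω).1)
    have h1 : Z * ∫ ω, {ω | F ω ≤ η * (IFG / IG)}.indicator (fun ω => G ω * w ω / IG) ω ∂μ ≤
        C * (C * (C * η) ^ c * Z) :=
      calc Z * ∫ ω, {ω | F ω ≤ η * (IFG / IG)}.indicator (fun ω => G ω * w ω / IG) ω ∂μ
          = ∫ ω, Z * {ω | F ω ≤ η * (IFG / IG)}.indicator (fun ω => G ω * w ω / IG) ω ∂μ :=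
            (integral_const_mul _ _).symm
        _ ≤ ∫ ω, C * ((if F ω * Z ≤ C * η * IF then (1 : ℝ) else 0) * w ω) ∂μ :=
            integral_mono_of_nonneg
              (ae_of_all _ fun ω =>
                mul_nonneg hZpos.le (Set.indicator_nonneg (fun ω _ => hρ0 ω) _))
              (hint.const_mul C) (ae_of_all _ hpt)
        _ = C * ∫ ω, (if F ω * Z ≤ C * η * IF then (1 : ℝ) else 0) * w ω ∂μ :=
            integral_const_mul _ _
        _ ≤ C * (C * (C * η) ^ c * Z) :=
            mul_le_mul_of_nonneg_left (hsmall (C * η) (mul_pos hC hη)) hC.le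
    have h2 : (∫ ω, {ω | F ω ≤ η * (IFG / IG)}.indicator (fun ω => G ω * w ω / IG) ω ∂μ) * Z ≤
        C ^ 2 * C ^ c * η ^ c * Z :=
      calc (∫ ω, {ω | F ω ≤ η * (IFG / IG)}.indicator (fun ω => G ω * w ω / IG) ω ∂μ) * Z
          = Z * ∫ ω, {ω | F ω ≤ η * (IFG / IG)}.indicator (fun ω => G ω * w ω / IG) ω ∂μ :=
            mul_comm _ _
        _ ≤ C * (C * (C * η) ^ c * Z) := h1
        _ = C ^ 2 * C ^ c * η ^ c * Z := by
            rw [Real.mul_rpow hC.le hη.le]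
            ring
    exact le_of_mul_le_mul_right h2 hZpos
  -- the layer-cake lemma on the tilted space
  obtain ⟨hνint, hνbound⟩ := hmain Ω ν₀ F (IFG / IG) hF hF0 hMpos hsmallν
  -- `{F = 0}` is `ν₀`-null, so the `ℝ≥0∞` power agrees `ν₀`-a.e. with the real power
  have hν₀zero : ν₀ {ω | F ω ≤ 0} = 0 := by
    have hle : ∀ η : ℝ, 0 < η → (ν₀ {ω | F ω ≤ 0}).toReal ≤ C ^ 2 * C ^ c * η ^ c := by
      intro η hη
      refine le_trans (ENNReal.toReal_mono (measure_ne_top _ _) (measure_mono ?_)) (hsmallν η hη)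
      intro ω hω
      have hω' : F ω ≤ 0 := hω
      show F ω ≤ η * (IFG / IG)
      exact hω'.trans (mul_nonneg hη.le hMpos.le)
    have hlim : Tendsto (fun η : ℝ => C ^ 2 * C ^ c * η ^ c) (𝓝[>] 0) (𝓝 0) := by
      have h1 : Tendsto (fun η : ℝ => η ^ c) (𝓝 0) (𝓝 ((0 : ℝ) ^ c)) :=
        (Real.continuousAt_rpow_const 0 c (Or.inr hc.le)).tendsto
      have h2 : Tendsto (fun η : ℝ => C ^ 2 * C ^ c * η ^ c) (𝓝 0)
          (𝓝 (C ^ 2 * C ^ c * (0 : ℝ) ^ c)) := h1.const_mul _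
      rw [Real.zero_rpow hc.ne', mul_zero] at h2
      exact h2.mono_left nhdsWithin_le_nhds
    have h0 : (ν₀ {ω | F ω ≤ 0}).toReal ≤ 0 :=
      ge_of_tendsto hlim (eventually_nhdsWithin_of_forall fun η hη => hle η hη)
    exact ((ENNReal.toReal_eq_zero_iff _).1 (le_antisymm h0 ENNReal.toReal_nonneg)).resolve_right
      (measure_ne_top _ _)
  have hae : ∀ᵐ ω ∂ν₀, ENNReal.ofReal (F ω) ^ (-ε) = ENNReal.ofReal (F ω ^ (-ε)) := by
    have h : ∀ᵐ ω ∂ν₀, ω ∉ {ω | F ω ≤ 0} := measure_eq_zero_iff_ae_notMem.1 hν₀zero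
    filter_upwards [h] with ω hω
    have hω' : ¬F ω ≤ 0 := hω
    exact ENNReal.ofReal_rpow_of_pos (not_le.1 hω')
  -- conclusion: multiply the `ν₀`-moment bound by `IG`
  have hFm : Measurable fun ω => ENNReal.ofReal (F ω) ^ (-ε) := hF.ennreal_ofReal.pow_const _
  have halg : IG * (K * (IFG / IG) ^ (-ε)) = K * IG ^ (1 + ε) * IFG ^ (-ε) := by
    rw [Real.div_rpow hFGpos.le hIGpos.le, Real.rpow_add hIGpos, Real.rpow_one, div_eq_mul_inv,
      ← Real.rpow_neg hIGpos.le, neg_neg]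
    ring
  calc ∫⁻ ω, ENNReal.ofReal (G ω * w ω) * ENNReal.ofReal (F ω) ^ (-ε) ∂μ
      = ∫⁻ ω, ENNReal.ofReal IG *
          (ENNReal.ofReal (G ω * w ω / IG) * ENNReal.ofReal (F ω) ^ (-ε)) ∂μ := by
        refine lintegral_congr fun ω => ?_
        rw [← mul_assoc, ← ENNReal.ofReal_mul hIGpos.le, mul_div_assoc',
          mul_div_cancel_left₀ _ hIGpos.ne']
    _ = ENNReal.ofReal IG *
          ∫⁻ ω, ENNReal.ofReal (G ω * w ω / IG) * ENNReal.ofReal (F ω) ^ (-ε) ∂μ :=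
        lintegral_const_mul' _ _ ENNReal.ofReal_ne_top
    _ = ENNReal.ofReal IG * ∫⁻ ω, ENNReal.ofReal (F ω) ^ (-ε) ∂ν₀ := by
        rw [hν₀_def, lintegral_withDensity_eq_lintegral_mul _ hρmeas.ennreal_ofReal hFm]
        rfl
    _ = ENNReal.ofReal IG * ∫⁻ ω, ENNReal.ofReal (F ω ^ (-ε)) ∂ν₀ := by
        rw [lintegral_congr_ae hae]
    _ = ENNReal.ofReal IG * ENNReal.ofReal (∫ ω, F ω ^ (-ε) ∂ν₀) := by
        rw [ofReal_integral_eq_lintegral_ofReal hνint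
          (ae_of_all _ fun ω => Real.rpow_nonneg (hF0 ω) _)]
    _ ≤ ENNReal.ofReal IG * ENNReal.ofReal (K * (IFG / IG) ^ (-ε)) :=
        mul_le_mul_right (ENNReal.ofReal_le_ofReal hνbound) _
    _ = ENNReal.ofReal (K * IG ^ (1 + ε) * IFG ^ (-ε)) := by
        rw [← ENNReal.ofReal_mul hIGpos.le, halg]

end Summit.QuantumFields.QCD.Cruxes.PhaseQuenchedFlavourDecay.CrossingSplitIntegrability
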